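import Summits.QuantumFields.BalabanUV.T4Continuum.Support.VariationalVectorLowerAvgG

/-!
# T⁴ programme, spine node NE2 (U1a), lane P2 — THE VECTOR END WITH RATE AND NO SLICE LAW: the (SLICE-min) socket of the END of record REPLACED by
# (G″) «V-AVG-G» + V-REG at fine minimisers (model level; cell `pub-balaban`)

NE2 formalisation swarm `b2b-balaban-t4-ne2-formalise-*`, leaf prover 10 GEN 4 (`prover-b2b-balaban-t4-ne2-formalise-leaf-10-g4-0`, V-END holder lineage); journal
INTENT «V-AVG-G: THE LOWER BRACKET WITHOUT A SLICE MOVE» CLAIMS.log 2026-08-20 18:22Z l.19093, file 2.  A sibling of this lineage's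
`VariationalVectorEndOfLeavesMin.towerLimitRate_effV_of_leaves_min` (p225541) — the SAME proof (rate lemmas `eV_level_le` ∕ `ePV_level_le` of p220074, the pair-to-rate
currency `VariationalVectorTower.towerLimitRate_effV_of_pairs` p218948, BY NAME) with the per-level bracket `VariationalAssemblySliceMin.vector_pair_bracket_sqrt_min_line`
(p224582) replaced by file 1's `VariationalVectorLowerAvgG.vector_pair_bracket_sqrt_avgG_line`; nothing defined.

THE CHANGED SOCKETS (w.r.t. p225541).  REMOVED: `hslice` ((SLICE-min) — with background the located obstruction of leaf-01-g7's memo `t4/T4-EST-NE2-P2-VGF.md`), the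
decay binders `σ, σ′ ≤ c·θ^k`, and the contractivity `hT′1` of the one-step carriers.  ADDED: **`hAVGG k`** — (G″) «V-AVG-G» at fine minimisers `g₀` of the level-`k`
composite fibre, `(n_k^d)⁻¹(n_k²·G k (QvL (T′ k) g₀)) ≤ (√(((n_kL)^d)⁻¹((n_kL)²·G′ k g₀)) + ε″ k·√(ρV′ k g₀))²`, `n_k = L^k`, with `ε″ k ≤ c_ε″·θ^k`; and **`hREGf k`** —
V-REG for the fine regularity functional `ρV′ k` at fine minimisers of the composite fibre (in two-step coordinates; inhabited from `hREG (k+1)` by transport along the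
`sites` identification — the suppliers' business, as for `hUBf` ∕ `hPf`).  Everything else — structural binders, COMP DATA identities, V-UB ∕ V-P at both levels, the
curl Federbush at `G := 0`, (ONE-min), V-REG, uniform constants, decay `δ, ε₁, δ′ ≤ c·θ^k`, `0 ≤ θ < 1`, `0 < a` — VERBATIM, and the conclusion is
  **`towerLimitRate_effV_of_leaves_avgG`**: `TowerLimitRate (fun _ ↦ 1) 1 (k ↦ effV (L^k) M (R k) (Gm k) (QmL (L^k) M (T k)) a) C θ`,
  `C = eV Λ⋆ (C_P⋆ + C_R′⋆) (c_δ + c_ε″) + ePV Λ⋆ C_P⋆ C_R⋆ c_ε c_δ′`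
— every term of `C` FIRST order in the decaying quantities (`c_δ`, `c_ε″`, `c_ε`, `c_δ′`); no `σ`-type multiplicative constant is left anywhere in the END.  With
background the END WITH RATE is thus reduced to the landed∕class leaves + (ONE-min) (leaf-01-g8's (C)₀ ∧ (G′) route, `hONEm_of_curl_oneG`) + (G″) (this item; its
decomposition DIV-AVG + HARM-APPROX↓ follows) + the two V-REG statements.  At `U = 1` the END of record stays the slice route (`VariationalVectorEndFlatMin`, p226153:
rate `L^{−2k}`, exact zero lower defect); the (G″) route is designed for background, where it trades the slice route's level-independent move cost for first-order
commutator defects.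

HONEST FRAMING (T4-DAG p. 1).  Model level, `E = ℂ`; transports ∕ carriers ∕ forms ∕ functionals DATA (no identification with Bałaban's objects — c5); [folklore]
plumbing + real arithmetic over tree theorems imported BY NAME; every leaf DISPLAYED, none discharged here — (G″) and (ONE-min) WITH BACKGROUND ARE OPEN; nothing
printed is a hypothesis; no `def`, no `def … : Prop`, no `sorry`; axioms standard.  V-END with background ∕ NE2 NOT proved; NE3 OPEN; spine PROVED 0∕9 unchanged;
rung (B)+1 finite T⁴ — NOT infinite volume, NOT mass gap, NOT Clay.  HONEST DEPENDENCY (cell, verbatim): continuum YM on T⁴ ⇐ BetaPertH ∧ nine spine estimates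
(0/9 proved); BetaPertH ⇐ (D1) ∧ (D4) ∧ CAP+tail; G-an2-4 gates asym, D1 and NE2/3/4.
-/

noncomputable section

namespace Summit.QuantumFields.BalabanUV.T4Continuum.VariationalVectorEndOfLeavesAvgG

open Finset
open scoped Matrix ComplexConjugate ComplexOrder Matrix.Norms.L2Operator BigOperators
open Literature.MathematicalPhysics.QuantumFieldTheory.Balaban1983to89.B5Prop11Plancherel (Tor fine unitVec)
open Literature.Analysis.Complex (qform)
open Summit.QuantumFields.BalabanUV.T4Continuum.VariationalTransfer (blockSpin)
open Summit.QuantumFields.BalabanUV.T4Continuum.VariationalColourTower (Rtrv)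
open Summit.QuantumFields.BalabanUV.T4Continuum.CovariantAveragingTower (TowerLimitRate)
open Summit.QuantumFields.BalabanUV.T4Continuum.VectorBlockTrialForm (nsqV nsqV_nonneg QvL compL)
open Summit.QuantumFields.BalabanUV.T4Continuum.VariationalVectorForm
open Summit.QuantumFields.BalabanUV.T4Continuum.VariationalVectorEffective (unc effV)
open Summit.QuantumFields.BalabanUV.T4Continuum.VariationalVectorAverage (continuous_QvL)
open Summit.QuantumFields.BalabanUV.T4Continuum.VariationalVectorTower (Gtr QmL QvL_surjective_of_ub towerLimitRate_effV_of_pairs)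
open Summit.QuantumFields.BalabanUV.T4Continuum.VariationalVectorEndOfLeaves
  (eV ePV eV_nonneg ePV_nonneg ePV_level_le eV_level_le nonneg_of_qform continuous_of_qform nonneg_of_Gtr continuous_of_Gtr)
open Summit.QuantumFields.BalabanUV.T4Continuum.VariationalVectorLowerAvgG (vector_pair_bracket_sqrt_avgG_line)

variable {d : ℕ}

section Tower

variable (L : ℕ) [NeZero L] (M : Fin d → ℕ) [hM : ∀ μ, NeZero (M μ)]
variable (R : (k : ℕ) → Tor (fine (L ^ k) M) → Fin d → (ℂ →L[ℂ] ℂ))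
variable (R' : (k : ℕ) → Tor (fine L (fine (L ^ k) M)) → Fin d → (ℂ →L[ℂ] ℂ))
variable (Gm : (k : ℕ) → Matrix (Tor (fine (L ^ k) M) × Fin d) (Tor (fine (L ^ k) M) × Fin d) ℂ)
variable (G : (k : ℕ) → (Tor (fine (L ^ k) M) → Fin d → ℂ) → ℝ)
variable (G' : (k : ℕ) → (Tor (fine L (fine (L ^ k) M)) → Fin d → ℂ) → ℝ)
variable (T : (k : ℕ) → Tor M → (Fin d → Fin (L ^ k)) → Fin (L ^ k) → Fin d → (ℂ →L[ℂ] ℂ))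
variable (T' : (k : ℕ) → Tor (fine (L ^ k) M) → (Fin d → Fin L) → Fin L → Fin d → (ℂ →L[ℂ] ℂ))

/-- **THE VECTOR END OF ROAD P2 WITH RATE AND NO SLICE LAW.**  As `towerLimitRate_effV_of_leaves_min` (p225541) with the (SLICE-min) socket, its decay binders
`σ, σ′` and the contractivity of `T′ k` REMOVED, and two sockets ADDED: `hAVGG k` ((G″) «V-AVG-G» at fine minimisers of the composite fibre, square-root shape,
`ε″ k ≤ c_ε″·θ^k`) and `hREGf k` (V-REG for the fine regularity functional `ρV′ k` at those minimisers); structural binders, COMP DATA identities, V-UB ∕ V-P at both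
levels, the curl Federbush at `G := 0`, (ONE-min), V-REG, uniform constants, decay `δ, ε₁, δ′ ≤ c·θ^k`, `0 ≤ θ < 1`, `0 < a` VERBATIM; conclusion
`TowerLimitRate … (eV Λ⋆ (C_P⋆ + C_R′⋆) (c_δ + c_ε″) + ePV Λ⋆ C_P⋆ C_R⋆ c_ε c_δ′) θ`. [folklore] -/
theorem towerLimitRate_effV_of_leaves_avgG (hGm : ∀ k, (Gm k).PosSemidef) (hG : ∀ k W, G k W = qform (Gm k) (unc W))
    (hTcomp : ∀ k, T (k + 1) = compL (L ^ k) L M (T k) (T' k)) (hRtr : ∀ k, R (k + 1) = Rtrv (L ^ k) L M (R' k))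
    (hGtr : ∀ k, G (k + 1) = Gtr (L ^ k) L M (G' k))
    {a : ℝ} (ha : 0 < a)
    (Λ CP CR CR' δ ε₁ δ' ε'' : ℕ → ℝ) {Λs CPs CRs CRs' cδ cε cδ' cε'' θ : ℝ}
    (hΛ : ∀ k, 0 ≤ Λ k) (hΛs : ∀ k, Λ k ≤ Λs) (hCP : ∀ k, 0 ≤ CP k) (hCPs : ∀ k, CP k ≤ CPs) (hCR : ∀ k, 0 ≤ CR k) (hCRs : ∀ k, CR k ≤ CRs)
    (hCR' : ∀ k, 0 ≤ CR' k) (hCRs' : ∀ k, CR' k ≤ CRs')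
    (hδ : ∀ k, 0 ≤ δ k) (hε₁ : ∀ k, 0 ≤ ε₁ k) (hδ' : ∀ k, 0 ≤ δ' k) (hε'' : ∀ k, 0 ≤ ε'' k) (hθ : 0 ≤ θ) (hθ1 : θ < 1)
    (hδθ : ∀ k, δ k ≤ cδ * θ ^ k) (hεθ : ∀ k, ε₁ k ≤ cε * θ ^ k) (hδ'θ : ∀ k, δ' k ≤ cδ' * θ ^ k) (hε''θ : ∀ k, ε'' k ≤ cε'' * θ ^ k)
    {ρV : (k : ℕ) → (Tor (fine (L ^ k) M) → Fin d → ℂ) → ℝ} (hρ0 : ∀ k W, 0 ≤ ρV k W)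
    {ρV' : (k : ℕ) → (Tor (fine L (fine (L ^ k) M)) → Fin d → ℂ) → ℝ}
    -- leaf V-UB at both levels
    (hUBc : ∀ k (φ : Tor M → Fin d → ℂ), ∃ W, QvL (L ^ k) M (T k) W = φ ∧ ScV (L ^ k) M (R k) (G k) W ≤ Λ k * nsqV M φ)
    (hUBf : ∀ k (φ : Tor M → Fin d → ℂ), ∃ W', QvL (L ^ k) M (T k) (QvL L (fine (L ^ k) M) (T' k) W') = φ ∧
      SfV (L ^ k) L M (R' k) (G' k) W' ≤ Λ k * nsqV M φ)
    -- leaf V-P at both levels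
    (hPc : ∀ k W, qWV (L ^ k) M W ≤ CP k * (ScV (L ^ k) M (R k) (G k) W + nsqV M (QvL (L ^ k) M (T k) W)))
    (hPf : ∀ k W', qVV (L ^ k) L M W' ≤ CP k * (SfV (L ^ k) L M (R' k) (G' k) W' + nsqV M (QvL (L ^ k) M (T k) (QvL L (fine (L ^ k) M) (T' k) W'))))
    -- LOWER side: the CURL Federbush against the pure-curl fine form, (G″) «V-AVG-G» and V-REG AT FINE MINIMISERS OF THE COMPOSITE FIBRE
    (hFEDcurl : ∀ k W', ScV (L ^ k) M (R k) (fun _ => 0) (QvL L (fine (L ^ k) M) (T' k) W')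
      ≤ (Real.sqrt (SfV (L ^ k) L M (R' k) (fun _ => 0) W') + δ k * Real.sqrt (qVV (L ^ k) L M W')) ^ 2)
    (hAVGG : ∀ k (φ : Tor M → Fin d → ℂ) (g₀ : Tor (fine L (fine (L ^ k) M)) → Fin d → ℂ),
      QvL (L ^ k) M (T k) (QvL L (fine (L ^ k) M) (T' k) g₀) = φ →
      (∀ W', QvL (L ^ k) M (T k) (QvL L (fine (L ^ k) M) (T' k) W') = φ → SfV (L ^ k) L M (R' k) (G' k) g₀ ≤ SfV (L ^ k) L M (R' k) (G' k) W') →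
      ((((L ^ k : ℕ) : ℝ)) ^ d)⁻¹ * ((((L ^ k : ℕ) : ℝ)) ^ 2 * G k (QvL L (fine (L ^ k) M) (T' k) g₀))
        ≤ (Real.sqrt (((((L ^ k : ℕ) : ℝ) * L) ^ d)⁻¹ * (((((L ^ k : ℕ) : ℝ)) * L) ^ 2 * G' k g₀)) + ε'' k * Real.sqrt (ρV' k g₀)) ^ 2)
    (hREGf : ∀ k (φ : Tor M → Fin d → ℂ) (g : Tor (fine L (fine (L ^ k) M)) → Fin d → ℂ),
      QvL (L ^ k) M (T k) (QvL L (fine (L ^ k) M) (T' k) g) = φ →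
      (∀ W', QvL (L ^ k) M (T k) (QvL L (fine (L ^ k) M) (T' k) W') = φ → SfV (L ^ k) L M (R' k) (G' k) g ≤ SfV (L ^ k) L M (R' k) (G' k) W') →
      ρV' k g ≤ CR' k * (SfV (L ^ k) L M (R' k) (G' k) g + nsqV M φ))
    -- UPPER side: leaf V-ONE AT COARSE MINIMISERS INTO THE COMPOSITE FIBRE (square-root shape), and leaf V-REG
    (hONEm : ∀ k (φ : Tor M → Fin d → ℂ) (W₀ : Tor (fine (L ^ k) M) → Fin d → ℂ), QvL (L ^ k) M (T k) W₀ = φ →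
      (∀ W, QvL (L ^ k) M (T k) W = φ → ScV (L ^ k) M (R k) (G k) W₀ ≤ ScV (L ^ k) M (R k) (G k) W) →
      ∃ g, QvL (L ^ k) M (T k) (QvL L (fine (L ^ k) M) (T' k) g) = φ ∧
        SfV (L ^ k) L M (R' k) (G' k) g ≤ (Real.sqrt (ScV (L ^ k) M (R k) (G k) W₀ + ε₁ k * ρV k W₀) + δ' k * Real.sqrt (qWV (L ^ k) M W₀)) ^ 2)
    (hREG : ∀ k (φ : Tor M → Fin d → ℂ) W, QvL (L ^ k) M (T k) W = φ →
      (∀ W₂, QvL (L ^ k) M (T k) W₂ = φ → ScV (L ^ k) M (R k) (G k) W ≤ ScV (L ^ k) M (R k) (G k) W₂) →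
      ρV k W ≤ CR k * (ScV (L ^ k) M (R k) (G k) W + nsqV M φ)) :
    TowerLimitRate (ι := fun _ => Tor M × Fin d) (fun _ => (1 : Matrix (Tor M × Fin d) (Tor M × Fin d) ℂ)) 1
      (fun k => effV (L ^ k) M (R k) (Gm k) (QmL (L ^ k) M (T k)) a)
      (eV Λs (CPs + CRs') (cδ + cε'') + ePV Λs CPs CRs cε cδ') θ := by
  -- (GF0) and continuity at every level, from the matrix form and one step up through `Gtr`
  have hG0 : ∀ k W, 0 ≤ G k W := fun k => nonneg_of_qform (L ^ k) M (hGm k) (hG k)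
  have hGc : ∀ k, Continuous (G k) := fun k => continuous_of_qform (L ^ k) M (hG k)
  have hG0' : ∀ k W', 0 ≤ G' k W' := fun k => nonneg_of_Gtr (L ^ k) L M (hGtr k) (hG0 (k + 1))
  have hGc' : ∀ k, Continuous (G' k) := fun k => continuous_of_Gtr (L ^ k) L M (hGtr k) (hGc (k + 1))
  -- the starred constants are nonnegative (level 0)
  have hθ1' : θ ≤ 1 := hθ1.le
  have hΛs0 : 0 ≤ Λs := (hΛ 0).trans (hΛs 0)
  have hCPs0 : 0 ≤ CPs := (hCP 0).trans (hCPs 0)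
  have hCRs0 : 0 ≤ CRs := (hCR 0).trans (hCRs 0)
  have hCRs0' : 0 ≤ CRs' := (hCR' 0).trans (hCRs' 0)
  have hcδ : 0 ≤ cδ := by have := (hδ 0).trans (hδθ 0); simpa using this
  have hcε : 0 ≤ cε := by have := (hε₁ 0).trans (hεθ 0); simpa using this
  have hcδ' : 0 ≤ cδ' := by have := (hδ' 0).trans (hδ'θ 0); simpa using this
  have hcε'' : 0 ≤ cε'' := by have := (hε'' 0).trans (hε''θ 0); simpa using this
  have hE0 : 0 ≤ eV Λs (CPs + CRs') (cδ + cε'') := eV_nonneg hΛs0 (add_nonneg hCPs0 hCRs0') (add_nonneg hcδ hcε'')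
  have hEP0 : 0 ≤ ePV Λs CPs CRs cε cδ' := ePV_nonneg hΛs0 hCPs0 hCRs0 hcε hcδ'
  have hC : 0 ≤ eV Λs (CPs + CRs') (cδ + cε'') + ePV Λs CPs CRs cε cδ' := add_nonneg hE0 hEP0
  -- per-level rates of the two defects
  have he : ∀ k, eV (Λ k) (CP k + CR' k) (δ k + ε'' k) ≤ (eV Λs (CPs + CRs') (cδ + cε'') + ePV Λs CPs CRs cε cδ') * θ ^ k := fun k => by
    have hsum : δ k + ε'' k ≤ (cδ + cε'') * θ ^ k := by rw [add_mul]; exact add_le_add (hδθ k) (hε''θ k)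
    have h1 := eV_level_le k (hΛ k) (hΛs k) (add_nonneg (hCP k) (hCR' k)) (add_le_add (hCPs k) (hCRs' k)) (add_nonneg (hδ k) (hε'' k))
      hθ hθ1' hsum
    have h2 : 0 ≤ ePV Λs CPs CRs cε cδ' * θ ^ k := mul_nonneg hEP0 (pow_nonneg hθ k)
    linarith [add_mul (eV Λs (CPs + CRs') (cδ + cε'')) (ePV Λs CPs CRs cε cδ') (θ ^ k)]
  have he' : ∀ k, ePV (Λ k) (CP k) (CR k) (ε₁ k) (δ' k) ≤ (eV Λs (CPs + CRs') (cδ + cε'') + ePV Λs CPs CRs cε cδ') * θ ^ k := fun k => by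
    have h1 := ePV_level_le k (hΛ k) (hΛs k) (hCP k) (hCPs k) (hCR k) (hCRs k) (hε₁ k) hcε (hδ' k) hcδ' hθ hθ1' (hεθ k) (hδ'θ k)
    have h2 : 0 ≤ eV Λs (CPs + CRs') (cδ + cε'') * θ ^ k := mul_nonneg hE0 (pow_nonneg hθ k)
    linarith [add_mul (eV Λs (CPs + CRs') (cδ + cε'')) (ePV Λs CPs CRs cε cδ') (θ ^ k)]
  -- the brackets, level by level, fed to the pair-to-rate currency
  exact towerLimitRate_effV_of_pairs L M R R' Gm G G' T T' hGm hG (fun k => QvL_surjective_of_ub (L ^ k) M (hUBc k)) hPc hTcomp hRtr hGtr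
    ha hC hθ hθ1 (fun k => eV (Λ k) (CP k + CR' k) (δ k + ε'' k)) (fun k => ePV (Λ k) (CP k) (CR k) (ε₁ k) (δ' k)) he he'
    fun k φ => by
      have h := vector_pair_bracket_sqrt_avgG_line (L ^ k) L M (continuous_QvL (L ^ k) M (T k)) (hG0 k) (hGc k) (hG0' k) (hGc' k)
        (hΛ k) (hCP k) (hCR k) (hCR' k) (hδ k) (hε₁ k) (hδ' k) (hε'' k) (hρ0 k) (ρ' := ρV' k) (hUBc k) (hUBf k) (hPc k) (hPf k)
        (hFEDcurl k) (fun φ g₀ hg₀ hmin => by simpa only [Nat.cast_pow] using hAVGG k φ g₀ hg₀ hmin) (hREGf k) (hONEm k) (hREG k) φ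
      simpa only [Nat.cast_pow] using h

end Tower

end Summit.QuantumFields.BalabanUV.T4Continuum.VariationalVectorEndOfLeavesAvgG

end
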